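import Summits.BirchSwinnertonDyer.BirchSwinnertonDyer.Theorems.CMKolyvaginAtInertTwoFullOrderPairCebotarevAtTwo
import Summits.BirchSwinnertonDyer.BirchSwinnertonDyer.Theorems.GenusKolyvaginAtTwoPowDvdShaCardAtTwoRTDeepPairChebotarev
import HarnessLib

/-!
# Route `CMKolyvaginAtInertTwo`, crux `CMKolyvaginExactAtInertTwo` (stmt-BirchSwinnertonDyer-24277), `stub_lower` —
# PORT OF gk2's LINE 18, FILE B0: THE ČEBOTAREV SOCKETS OF THE KS ASSEMBLY ON THE CM-INERT HABITAT —
# (a) Kolyvagin primes at `2` of every depth with Gross's Frobenius condition; (b) the DEEP full-order pair Čebotarev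

Seat `bsd-line-cmk2-p1` g19 (cell `bsd-print-cf2`), `--supports stmt-BirchSwinnertonDyer-24277` (helper; closes nothing).
THEOREMS ONLY (no definition, no named fact, no `sorry`).  BSD is NOT proved by any of this; the crux is not closed here.

WHAT.  The KS assembly of gk2's LINE 18 (McCallum Prop. 5.2 at `2`: `…RTKolyvaginMinimaPred`, `…RTExactSwapCoreFrob`,
`…RTBottomRungEngineDeepTwoN`) draws its Kolyvagin primes from two Čebotarev statements typed with `¬ W.HasCM` and
`ρ_{E,2^∞} = GL₂(ℤ₂)`: the EMPTY-family form of Q5R at level `2^M` (square-free products of the class exist,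
`RelaxedCount.exists_squarefree_card_primeFactors_kolyvagin_margin`) and gk2-p4's DEEP full-order pair Čebotarev
`PlusDescent.infinite_kolyvaginPrime_localization_fullOrder_pair_deep` (classes at level `2^M`, primes with `Frob_ℓ = Frob_∞` on
`K(E[2^{M+k}])`, separation hypothesis `hres` read at the deep level).  On H₂ (`W` CM, `2` inert in the CM field, `ρ̄_{E,2}` onto,
`K` imaginary quadratic with the Heegner hypothesis) both are theorems WITHOUT any separation hypothesis, because
`H¹(K(E[2^M])/K, E[2^M]) = 0` at every level (g16 `KolyvaginImageTwo.h1_restriction_injective_two_pow_of_cmInert`):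
* `infinite_kolyvaginPrime_frob_of_cmInert` — infinitely many `ℓ` with `FrobEqFrobInfty W K (2^M) ℓ`, Zhang–Kolyvagin at `2`,
  index `≥ M`, `CMInert W ℓ` (g7's leaf `exists_kolyvaginPrime_gt_two_pow_of_targets` with the empty family; bookkeeping as in g16's
  `infinite_kolyvaginPrime_localization_fullOrder_pair_of_cmInert`);
* `infinite_kolyvaginPrime_localization_fullOrder_pair_deep_of_cmInert` — gk2-p4's deep pair theorem on H₂: g16's level-`2^{M+k}`
  socket applied to `ι x, ι y` (`ι` injective and `Aut(K/ℚ)`-equivariant, `E(K)[2] = 0`), local kernels moved back to level `2^M`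
  because `Γ_{K_λ}` fixes `E[2^{M+k}]` at a prime of index `≥ M + k` (gk2-p4's proof verbatim, credit gk2-p4 g19; `hres` GONE).

References: [McCallumLMS1991] §3 Cor. 3.2, §4 (5), Lemma 4.6, §5 proof of Prop. 5.2; [GrossLMS1991] §3 (3.1)–(3.3), §9 Props. 9.1, 9.3;
[Howard2004Duke] Thm. 3.2.2 (proof).
-/

-- single-conjunct summit: `Summit.BirchSwinnertonDyer.BirchSwinnertonDyer.…` repeats the name by design
set_option linter.dupNamespace false
set_option autoImplicit false

noncomputable section

open scoped Classical
open WeierstrassCurve NumberField IsDedekindDomain Field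
open Literature.NumberTheory.GaloisRepresentations Literature.NumberTheory.EllipticCurves
open Summit.BirchSwinnertonDyer.Rank1Residual.JET.GlobalDuality (galoisRep_toLocal_apply_eq_self)

namespace Summit.BirchSwinnertonDyer.BirchSwinnertonDyer.Theorems.KolyvaginLowerTwo

variable (W : WeierstrassCurve ℚ) [W.IsElliptic] [W.IsGloballyMinimal] [NeZero (W.conductorNorm ℤ)]
  (K : Type) [Field K] [NumberField K]

/-! ## (a) Kolyvagin primes of every depth with Gross's Frobenius condition, on H₂ -/

/-- **Infinitely many Zhang–Kolyvagin primes at `2` of index `≥ M` with `Frob_ℓ = Frob_∞` on `K(E[2^M])` (and inert in the CM field),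
on the CM-inert habitat** — the empty-family case of McCallum's Cor. 3.2 at `2`: g7's leaf `exists_kolyvaginPrime_gt_two_pow_of_targets`
with `r = 0` (the regular-module inputs `hzfix`/`hcomm` supplied by the habitat as in g16's pair theorem), the index from the Frobenius
condition (`McCallum1991.le_kolyvaginIndex_of_frobEqFrobInfty`), inertness in `F` from `KolyvaginDescentTwo.cmInert_of_isKolyvaginPrime_two`.
[cite: McCallumLMS1991, §3 Cor. 3.2] [cite: GrossLMS1991, §3 (3.1)–(3.3)] -/
theorem infinite_kolyvaginPrime_frob_of_cmInert (hCM : W.HasCM)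
    (hin : Literature.NumberTheory.EllipticCurves.Rank1Residual.CMInert W 2)
    (hρ : W.HasSurjectiveModNGaloisRep 2) (hK : IsImaginaryQuadratic K)
    (hH : SatisfiesHeegnerHypothesis (W.conductorNorm ℤ) K) (c : K ≃ₐ[ℚ] K) (hc : c ≠ 1) (M : ℕ) (hM : 1 ≤ M) :
    Set.Infinite {ℓ : ℕ | FrobEqFrobInfty W K (2 ^ M) ℓ ∧
      Zhang2014.IsKolyvaginPrime (W.conductorNorm ℤ) W K 2 ℓ ∧ M ≤ Zhang2014.kolyvaginIndex W 2 ℓ ∧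
      Literature.NumberTheory.EllipticCurves.Rank1Residual.CMInert W ℓ} := by
  haveI : Fact (Nat.Prime 2) := ⟨Nat.prime_two⟩
  -- ### the habitat inputs
  have hΔ : W.Δ < 0 := KolyvaginEigenTwo.Δ_neg_of_cmInert_two W hCM hin hρ
  have hΔK : ¬ IsSquare (W.baseChange K).Δ := by
    have h : (W.baseChange K).Δ = algebraMap ℚ K W.Δ := by rw [baseChange, map_Δ]
    rw [h]
    exact KolyvaginImageTwo.not_isSquare_algebraMap_Δ_of_cmInert_two_of_heegner W hCM hin hρ K hK hH
  obtain ⟨z, -, hzfix⟩ := KolyvaginImageTwo.exists_smul_three_of_hasSurjectiveModNGaloisRep W K hK.1 hρ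
  have hcomm : ∀ π ∈ torsionFixing (W.baseChange K) ((2 : ℕ) : ℤ),
      ∀ P : geomTorsion (W.baseChange K) ((2 ^ M : ℕ) : ℤ), π • z • P = z • π • P :=
    Summit.BirchSwinnertonDyer.Rank1Residual.P2.CartanAtTwo.hcomm_of_habitat W K hCM hin hρ hzfix
  have h2M : 2 ∣ 2 ^ M := dvd_pow_self 2 (by omega)
  obtain ⟨c₀, hc₀⟩ := exists_isComplexConjugation (Rat.castHom ℝ)
  -- ### infinitely many primes: one above every bound (empty family)
  refine Set.infinite_of_forall_exists_gt fun b ↦ ?_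
  obtain ⟨ℓ, hbℓ, hℓ, hℓN, hℓD, hℓ2, hprime, hfrob, -⟩ :=
    KolyvaginImageTwo.exists_kolyvaginPrime_gt_two_pow_of_targets
      Literature.NumberTheory.Automorphic.chebotarev_artinRep_holds (N := W.conductorNorm ℤ) W hK hρ hΔK hc hc₀ hM hzfix hcomm
      ![] id ![] (fun i ↦ i.elim0) ![] (fun i ↦ i.elim0) (fun _ _ i ↦ i.elim0) ![] (fun i ↦ i.elim0) b
  have hidx : M ≤ Zhang2014.kolyvaginIndex W 2 ℓ :=
    McCallum1991.le_kolyvaginIndex_of_frobEqFrobInfty W K Nat.prime_two hM hℓ hℓ2 hℓN hfrob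
  have hZ : Zhang2014.IsKolyvaginPrime (W.conductorNorm ℤ) W K 2 ℓ :=
    ⟨hℓ, hℓN, hℓD, hℓ2, hprime, lt_of_lt_of_le (by omega) hidx⟩
  have hG : IsKolyvaginPrime (W.conductorNorm ℤ) W K 2 ℓ :=
    ⟨hℓ, hℓN, hℓD, hℓ2, hprime, FrobEqFrobInfty.of_dvd (W := W) (K := K) h2M hfrob⟩
  have hF : Literature.NumberTheory.EllipticCurves.Rank1Residual.CMInert W ℓ :=
    KolyvaginDescentTwo.cmInert_of_isKolyvaginPrime_two W hCM hin hρ hG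
  exact ⟨ℓ, ⟨hfrob, hZ, hidx, hF⟩, hbℓ⟩

/-! ## (b) The deep full-order pair Čebotarev on H₂ (no separation hypothesis) -/

/-- **THE DEEP FULL-ORDER PAIR ČEBOTAREV AT `2` ON THE CM-INERT HABITAT.**  `W/ℚ` globally minimal with CM, `2` inert in the CM
field, `ρ̄_{E,2}` onto; `K` imaginary quadratic with the Heegner hypothesis for `N_E`; `c ≠ 1` in `Gal(K/ℚ)`; `M ≥ 1`, any `k`.
For eigenclasses `x, y ∈ H¹(K, E[2^M])` (`c_* x = ±x`, `c_* y = ±y`, any signs) of orders `2^m`, `2^κ` (`m, κ ≥ 1`) there are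
infinitely many Kolyvagin primes `ℓ` at `2` with `Frob_ℓ = Frob_∞` on `K(E[2^{M+k}])` (so index `≥ M + k`) at whose place `x` has local
order exactly `2^m` and `y` exactly `2^κ` (level-`2^M` local kernels).  gk2-p4's `infinite_kolyvaginPrime_localization_fullOrder_pair_deep`
with its separation hypothesis `hres` REMOVED (no phantom classes on H₂): g16's level-`2^{M+k}` socket for `ι x, ι y`, then the local
kernels agree along `ι` since `Γ_{K_λ}` fixes `E[2^{M+k}]`.  [cite: McCallumLMS1991, §3 Cor. 3.2, §4 (5) and Lemma 4.6, §5 proof of Prop. 5.2]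
[cite: Howard2004Duke, Thm. 3.2.2 (proof)] -/
theorem infinite_kolyvaginPrime_localization_fullOrder_pair_deep_of_cmInert (hCM : W.HasCM)
    (hin : Literature.NumberTheory.EllipticCurves.Rank1Residual.CMInert W 2)
    (hρ2 : W.HasSurjectiveModNGaloisRep 2) (hK : IsImaginaryQuadratic K)
    (hH : SatisfiesHeegnerHypothesis (W.conductorNorm ℤ) K) (c : K ≃ₐ[ℚ] K) (hc : c ≠ 1)
    (M k : ℕ) (hM : 1 ≤ M) (x y : galH1Torsion (W.baseChange K) ((2 ^ M : ℕ) : ℤ))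
    {m κ : ℕ} (hm : 1 ≤ m) (hκ : 1 ≤ κ) (hx : addOrderOf x = 2 ^ m) (hy : addOrderOf y = 2 ^ κ)
    {sx sy : ℤ} (hsx : sx = 1 ∨ sx = -1) (hsy : sy = 1 ∨ sy = -1)
    (hτx : conjAct W c ((2 ^ M : ℕ) : ℤ) x = sx • x) (hτy : conjAct W c ((2 ^ M : ℕ) : ℤ) y = sy • y) :
    Set.Infinite {ℓ : ℕ | FrobEqFrobInfty W K (2 ^ (M + k)) ℓ ∧ Zhang2014.IsKolyvaginPrime (W.conductorNorm ℤ) W K 2 ℓ ∧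
      M + k ≤ Zhang2014.kolyvaginIndex W 2 ℓ ∧
      ∀ v : HeightOneSpectrum (𝓞 K), (ℓ : 𝓞 K) ∈ v.asIdeal →
        (∀ j : ℕ, ((2 ^ j : ℕ) : ℤ) • x ∈ (W.baseChange K).torsionLocalKer (v.adicCompletion K) ((2 ^ M : ℕ) : ℤ) ↔ m ≤ j) ∧
        ∀ j : ℕ, ((2 ^ j : ℕ) : ℤ) • y ∈ (W.baseChange K).torsionLocalKer (v.adicCompletion K) ((2 ^ M : ℕ) : ℤ) ↔ κ ≤ j} := by
  haveI : Fact (Nat.Prime 2) := ⟨Nat.prime_two⟩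
  haveI : (W.baseChange K).IsElliptic := inferInstanceAs (W.map (algebraMap ℚ K)).IsElliptic
  have hdvd := natCast_pow_dvd_natCast_pow_add 2 M k
  set ι := torsionH1OfDvd (W.baseChange K) hdvd with hιdef
  have hιinj : Function.Injective ι := GenusExact.PlusDescent.torsionH1OfDvd_two_pow_injective W K hK hρ2 M k
  -- ### the shifted classes
  set x' : galH1Torsion (W.baseChange K) ((2 ^ (M + k) : ℕ) : ℤ) := ι x with hx'def
  set y' : galH1Torsion (W.baseChange K) ((2 ^ (M + k) : ℕ) : ℤ) := ι y with hy'def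
  have hx' : addOrderOf x' = 2 ^ m := by rw [hx'def, addOrderOf_injective ι hιinj, hx]
  have hy' : addOrderOf y' = 2 ^ κ := by rw [hy'def, addOrderOf_injective ι hιinj, hy]
  have hτx' : conjAct W c ((2 ^ (M + k) : ℕ) : ℤ) x' = sx • x' := by
    rw [hx'def, hιdef, conjAct_torsionH1OfDvd, hτx, map_zsmul]
  have hτy' : conjAct W c ((2 ^ (M + k) : ℕ) : ℤ) y' = sy • y' := by
    rw [hy'def, hιdef, conjAct_torsionH1OfDvd, hτy, map_zsmul]
  have hMk : 1 ≤ M + k := le_trans hM (Nat.le_add_right M k)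
  have hinf := KolyvaginImageTwo.infinite_kolyvaginPrime_localization_fullOrder_pair_of_cmInert_socket W K hCM hin hρ2 hK hH c hc
    (M + k) hMk x' y' hm hκ hx' hy' hsx hsy hτx' hτy'
  refine hinf.mono fun ℓ hℓ ↦ ?_
  obtain ⟨hFrob, hKol, hidx, hloc⟩ := hℓ
  refine ⟨hFrob, hKol, hidx, fun v hv ↦ ?_⟩
  obtain ⟨hlx, hly⟩ := hloc v hv
  -- ### `Γ_{K_λ}` fixes `E[2^{M+k}]`: the level-`2^M` and level-`2^{M+k}` local kernels agree along `ι`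
  have htriv : ∀ (g : absoluteGaloisGroup (v.adicCompletion K)) (Q : geomTorsion (W.baseChange K) ((2 ^ (M + k) : ℕ) : ℤ)),
      resGal (K := K) (v.adicCompletion K) g • Q = Q := fun g Q ↦ by
    rw [resGal_eq_absGaloisRestrict]
    exact galoisRep_toLocal_apply_eq_self W K hK hKol hidx v hv g Q
  have hpd : 2 ^ M ∣ 2 ^ (M + k) := pow_dvd_pow 2 (Nat.le_add_right M k)
  have e : ∀ z : galH1Torsion (W.baseChange K) ((2 ^ M : ℕ) : ℤ),
      z ∈ (W.baseChange K).torsionLocalKer (v.adicCompletion K) ((2 ^ M : ℕ) : ℤ) ↔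
        ι z ∈ (W.baseChange K).torsionLocalKer (v.adicCompletion K) ((2 ^ (M + k) : ℕ) : ℤ) := fun z ↦
    mem_torsionLocalKer_iff_torsionH1OfDvd_mem (W.baseChange K) (v.adicCompletion K) hpd (pow_ne_zero M two_ne_zero)
      (pow_ne_zero _ two_ne_zero) htriv z
  refine ⟨fun j ↦ ?_, fun j ↦ ?_⟩
  · rw [e, map_zsmul]
    exact hlx j
  · rw [e, map_zsmul]
    exact hly j

end Summit.BirchSwinnertonDyer.BirchSwinnertonDyer.Theorems.KolyvaginLowerTwo

end
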